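import Literature.NumberTheory.Automorphic.IdeleClassGaloisRepFundamentalClass
import Literature.Algebra.Homology.ClassModuleTransport
import HarnessLib

/-!
# Compatibility of the fundamental classes under restriction in a tower `F ⊆ E ⊆ M`:
# `Res_{Gal(M/E)} u_{M/F} = u_{M/E}` (Serre, *Local Fields* XI §3; Neukirch, *Bonn Lectures* II §1
# Prop. (1.6) b)) for the idèle class layers

Topic `NumberTheory/Automorphic` (ideles, idele classes); namespace
`Literature.NumberTheory.Automorphic.IdeleClassGroup`.  Proof file: theorems only (no definition, no named
fact, no instance, no notation; D-0026).  Companion of `IdeleClassGaloisRepInflation` (door-c4 g11: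
`Inf u_{E/F} = [M:E] · u_{M/F}`): the second of Serre's formulas, for the SUB-layer `M/E` of `M/F`.  Engine:
`IsClassModule.res_mapCocycles₂` (a class module restricts to every subgroup, `ClassModule`) and
`IsClassModule.of_iso` / `LayerIso.H2π_transport` (`ClassModuleTransport`); the identification
`Gal(M/E) ≅ ker res_E ≤ Gal(M/F)` is `IdeleClassGaloisRepNormalLayer.bijective_restrictScalars_codRestrict_ker`,
and the action of `τ ∈ Gal(M/E)` on `C_M` is that of `τ|^F` (`classGalAct_restrictScalars`).

Source.  J.-P. Serre, *Local Fields*, GTM 67 (1979), XI §3 [printed p. 168]: "`Res(u_{F/E}) = u_{F/E'}`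
if `F ⊃ E' ⊃ E`"; J. Neukirch, *Class Field Theory — The Bonn Lectures* (2013), II §1 Prop. (1.6) b):
"`res_L(u_{N|K}) = u_{N|L}`".

Dictionary.  "Res : H²(Gal(M/F), C_M) → H²(Gal(M/E), C_M)" is Mathlib's `groupCohomology.map r κ 2` along the
inclusion `r = AlgEquiv.restrictScalarsHom F : Gal(M/E) → Gal(M/F)` and the identity coefficient map
`κ : Res_r C_M ⟶ C_M` of `galoisRep F M` onto `galoisRep E M` (same module `Additive C_M`; existence
`exists_resCoeffHom`, characterised by `κ.hom a = a`).

## Main statements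
* `exists_resCoeffHom` — the identity `κ : Res_r (galoisRep F M) ⟶ galoisRep E M` is `Gal(M/E)`-equivariant.
* **`exists_isClassModule_map_restrictScalarsHom_eq`** — for every fundamental class `u_{M/F}` of
  `(Gal(M/F), C_M)`, `Res u_{M/F}` IS a fundamental class of `(Gal(M/E), C_M)`: there is a class-module
  structure `u_{M/E}` on `galoisRep E M` with `Res u_{M/F} = u_{M/E}`.

## References
* J.-P. Serre, *Local Fields*, GTM 67, Springer (1979), XI §3 (formulas for `u_{F/E}`). [SerreLocalFields1979]
* J. Neukirch, *Class Field Theory — The Bonn Lectures*, Springer (2013), Part II §1 Prop. (1.6) b).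
  [Neukirch2013]
-/

noncomputable section

open NumberField CategoryTheory CategoryTheory.Limits groupCohomology
open scoped NumberField

namespace Literature.NumberTheory.Automorphic

namespace IdeleClassGroup

open Literature.NumberTheory.GaloisRepresentations Literature.Algebra.Homology

section Restriction

variable {F E M : Type} [Field F] [Field E] [Field M] [Algebra F E] [Algebra F M] [Algebra E M]
  [IsScalarTower F E M] [NumberField F] [NumberField E] [NumberField M] [IsGalois F E] [IsGalois F M]

omit [NumberField F] [NumberField E] [IsGalois F E] [IsGalois F M] in
/-- **The identity of `C_M` is a morphism `Res_r (galoisRep F M) ⟶ galoisRep E M`** along the inclusion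
`r : Gal(M/E) → Gal(M/F)`, `τ ↦ τ|^F` (the action of `τ` on `C_M` is that of `τ|^F`,
`classGalAct_restrictScalars`) — the coefficient map of "Res". [cite: SerreLocalFields1979, Ch. XI §3]
[cite: CasselsFrohlichANT1967, Ch. VII §8] -/
theorem exists_resCoeffHom :
    ∃ κ : Rep.res (AlgEquiv.restrictScalarsHom F : (M ≃ₐ[E] M) →* (M ≃ₐ[F] M)) (galoisRep F M) ⟶
        galoisRep E M, ∀ a, κ.hom a = a := by
  refine ⟨Rep.ofHom ⟨LinearMap.id, fun τ => LinearMap.ext fun a => ?_⟩, fun a => rfl⟩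
  change (galoisRep F M).ρ (AlgEquiv.restrictScalarsHom F τ) a = (galoisRep E M).ρ τ a
  rw [galoisRep_ρ_apply, galoisRep_ρ_apply, AlgEquiv.restrictScalarsHom_apply, classGalAct_restrictScalars]

variable (κ : Rep.res (AlgEquiv.restrictScalarsHom F : (M ≃ₐ[E] M) →* (M ≃ₐ[F] M)) (galoisRep F M) ⟶
    galoisRep E M) (hκ : ∀ a, κ.hom a = a)

omit [NumberField F] [NumberField E] [IsGalois F M] in
include hκ in
/-- **Serre XI §3 / Neukirch II (1.6) b): `Res_{Gal(M/E)} u_{M/F} = u_{M/E}`.**  For every fundamental class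
`u_{M/F} = [φ_M]` of the layer `(Gal(M/F), C_M)` (a class-module structure), its restriction
`Res u_{M/F} = map r κ 2 [φ_M] ∈ H²(Gal(M/E), C_M)` is a fundamental class of the layer `(Gal(M/E), C_M)`:
there is `φ` with `IsClassModule (galoisRep E M) φ` and `[φ] = Res [φ_M]`.  (Engine `IsClassModule.res_mapCocycles₂`
for the subgroup `ker res_E ≤ Gal(M/F)`, transported along `ker res_E ≅ Gal(M/E)` by `IsClassModule.of_iso`;
the two routes `Gal(M/E) → Gal(M/F)` agree, `groupCohomology.map_comp` / `map_congr`.)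
[cite: SerreLocalFields1979, Ch. XI §3 ("`Res(u_{F/E}) = u_{F/E'}`")][cite: Neukirch2013, Part II §1 Prop. (1.6) b)] -/
theorem exists_isClassModule_map_restrictScalarsHom_eq {φM : cocycles₂ (galoisRep F M)}
    (hM : IsClassModule (galoisRep F M) φM) :
    ∃ φ : cocycles₂ (galoisRep E M), IsClassModule (galoisRep E M) φ ∧
      H2π (galoisRep E M) φ =
        groupCohomology.map (AlgEquiv.restrictScalarsHom F : (M ≃ₐ[E] M) →* (M ≃ₐ[F] M)) κ 2
          (H2π (galoisRep F M) φM) := by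
  set H := (AlgEquiv.restrictNormalHom (F := F) (K₁ := M) E).ker with hH
  -- the class module `Res_H C_M` with class `res_H u_M`
  have hres := hM.res_mapCocycles₂ H
  -- `Gal(M/E) ≃ H`, `σ ↦ σ|^F`
  have hrmem : ∀ σ : M ≃ₐ[E] M,
      (AlgEquiv.restrictScalarsHom F : (M ≃ₐ[E] M) →* (M ≃ₐ[F] M)) σ ∈ H := fun σ =>
    restrictScalars_mem_ker (F := F) (E := E) (M := M) σ
  let e₀ : (M ≃ₐ[E] M) ≃* H := MulEquiv.ofBijective
    ((AlgEquiv.restrictScalarsHom F : (M ≃ₐ[E] M) →* (M ≃ₐ[F] M)).codRestrict H hrmem)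
    (bijective_restrictScalars_codRestrict_ker (F := F) (E := E) (M := M))
  let e : H ≃* (M ≃ₐ[E] M) := e₀.symm
  have he_coe : ∀ σ : M ≃ₐ[E] M, ((e.symm σ : H) : M ≃ₐ[F] M) = σ.restrictScalars F := fun _ => rfl
  -- the identity `Additive C_M ≃ Additive C_M` is `e`-equivariant
  let ε : (Rep.res H.subtype (galoisRep F M)).V ≃ₗ[ℤ] (galoisRep E M).V :=
    @LinearEquiv.refl ℤ (Additive (IdeleClassGroup M)) _ _ (AddCommGroup.toIntModule _)
  have hε : ∀ h : H, ε.toLinearMap ∘ₗ (Rep.res H.subtype (galoisRep F M)).ρ h =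
      (galoisRep E M).ρ (e h) ∘ₗ ε.toLinearMap := fun h => LinearMap.ext fun a => by
    change (galoisRep F M).ρ (h : M ≃ₐ[F] M) a = (galoisRep E M).ρ (e h) a
    rw [galoisRep_ρ_apply, galoisRep_ρ_apply, ← classGalAct_restrictScalars (F := F) (e h), ← he_coe (e h),
      MulEquiv.symm_apply_apply]
  refine ⟨_, hres.of_iso e ε hε, ?_⟩
  rw [LayerIso.H2π_transport e _ _ ε hε, H2π_mapCocycles₂_subtype]
  -- `Res = (transport iso) ∘ res_H`: both are `map` along `σ ↦ σ|^F`
  have h1 : (H.subtype).comp (e.symm : (M ≃ₐ[E] M) →* H) =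
      (AlgEquiv.restrictScalarsHom F : (M ≃ₐ[E] M) →* (M ≃ₐ[F] M)) :=
    MonoidHom.ext fun σ => he_coe σ
  have h2 : (Rep.resMap (e.symm : (M ≃ₐ[E] M) →* H)
      (𝟙 (Rep.res H.subtype (galoisRep F M))) ≫
        Rep.ofHom ⟨ε.toLinearMap, LayerIso.isIntertwining_symm e _ _ ε hε⟩).hom.toLinearMap =
      κ.hom.toLinearMap := by
    refine LinearMap.ext fun a => ?_
    change ε a = κ.hom a
    rw [hκ]
    rfl
  have hc := groupCohomology.map_comp H.subtype (e.symm : (M ≃ₐ[E] M) →* H)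
    (𝟙 (Rep.res H.subtype (galoisRep F M)))
    (Rep.ofHom ⟨ε.toLinearMap, LayerIso.isIntertwining_symm e _ _ ε hε⟩) 2
  have key : InflationRestriction.restriction H (galoisRep F M) 2 ≫
      (groupCohomology.mapIso e ε hε 2).hom =
      groupCohomology.map (AlgEquiv.restrictScalarsHom F : (M ≃ₐ[E] M) →* (M ≃ₐ[F] M)) κ 2 :=
    hc.symm.trans (groupCohomology.map_congr h1 h2 2)
  have key' := congrArg (fun f => (ModuleCat.Hom.hom f) (H2π (galoisRep F M) φM)) key
  simp only [ModuleCat.hom_comp, LinearMap.coe_comp, Function.comp_apply] at key'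
  exact key'

end Restriction

end IdeleClassGroup

end Literature.NumberTheory.Automorphic

end
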